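import Mathlib
import Summits.ValiantsHypothesis.ValiantsHypothesis.Theorems.FifoMatchingNNLinearDegreeCofactorHardQueueGenealogy
import HarnessLib

/-!
# Crux `NNLinearDegreeCofactorHard` (stmt-ValiantsHypothesis-23918), line `internal_cofactor`: the GENEALOGY of colour
# boundaries on the abstract queue history (piece (D*-1) of LEAD-HANDOFF §p2 / D3architecture §1)

On the abstract queue history (`…NNMonotoneHardBoundaries.lean`: item `k` is pushed at time `o k` and popped at `c k`; at time
`t` the front is item `rC t`; `σ` is respected), a COLOUR BOUNDARY is an item `k ≥ 1` whose colour `σ (o k)` differs from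
that of item `k − 1`.  A push at a time that agrees with its front copies the front's colour (`QueueHistory.replication`), so
new boundaries can only be COPIED from boundaries passing the front, or CREATED at test times:

* `rankO_opener`, `letter_opener`, `opener_lt_opener_iff` — item `k` is pushed at a push time, `rO (o k) = k`, and `o` is
  strictly increasing;
* `exists_boundary_between` — discrete intermediate value: if items `i < j` have different colours there is a boundary in
  `(i, j]`;
* `card_boundaries_pushed_le` — **genealogy**: the number of boundaries among the items pushed during `[a, b)` (items
  `rO a + 1, …, rO b − 1`) is at most the number of boundaries among the items `rC a + 1, …, rC b` (those passing the front
  during `[a, b]`) plus twice the number of test times in `[a, b)` (push times `t` with `σ t ≠ σ (o (rC t))`).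

Consequence used by (D*) (μ* = shedWord) and (D‴) (inflateWord): along a test-free stretch the number of colour blocks of the
queue does not increase from one generation to the next, and a mixed queue keeps passing boundaries through the front (each
passage = a gate or a test, `QueueHistory.disagreements_exhaustion_le_tests`).  Honest framing: deterministic bookkeeping
only; nothing here proves (D*), S11, S2b, the crux or VP ≠ VNP.  No definitions, no named facts.
-/

-- Sub = Summit single-conjunct layout: the duplicated namespace component is mandated by the tree.
set_option linter.dupNamespace false

namespace Summit.ValiantsHypothesis.ValiantsHypothesis.Theorems.FifoMatching.NNLinearDegreeCofactorHard.QueueHistory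

open Finset
open Summit.ValiantsHypothesis.ValiantsHypothesis.Theorems.FifoMatching.NNMonotoneHard

section AbstractQueue

variable {W σ : ℕ → Bool} {rO rC o c : ℕ → ℕ} {n' : ℕ}
variable (hOs : ∀ t, rO (t + 1) = rO t + (if W t = true then 1 else 0))
  (hCs : ∀ t, rC (t + 1) = rC t + (if W t = true then 0 else 1))
  (ho : ∀ k t, k < n' → (o k < t ↔ k < rO t))

/-! ### Items and their push times -/

include hOs ho in
/-- **Item `k` is the `k`-th push**: `rO (o k) = k`, and the letter at `o k` is a push. [folklore] -/
theorem rankO_opener {k : ℕ} (hk : k < n') : rO (o k) = k ∧ W (o k) = true := by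
  have h1 : ¬ k < rO (o k) := fun h => lt_irrefl _ ((ho k (o k) hk).2 h)
  have h2 : k < rO (o k + 1) := (ho k (o k + 1) hk).1 (Nat.lt_succ_self _)
  rw [hOs] at h2
  cases hW : W (o k)
  · rw [hW] at h2; simp at h2; omega
  · rw [hW] at h2; simp at h2; exact ⟨by omega, rfl⟩

include hOs ho in
/-- The letter at the push time of an item is a push. [folklore] -/
theorem letter_opener {k : ℕ} (hk : k < n') : W (o k) = true := (rankO_opener hOs ho hk).2

include hOs ho in
/-- Items are pushed in order: `o i < o j ↔ i < j`. [folklore] -/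
theorem opener_lt_opener_iff {i j : ℕ} (hi : i < n') (hj : j < n') : o i < o j ↔ i < j := by
  rw [ho i (o j) hi, (rankO_opener hOs ho hj).1]

/-! ### Discrete intermediate values -/

/-- If items `i < j` have different colours (under any `f`), some item `k ∈ (i, j]` differs from its predecessor.
[folklore] -/
theorem exists_boundary_between (f : ℕ → Bool) {i j : ℕ} (hij : i < j) (hne : f i ≠ f j) :
    ∃ k, i < k ∧ k ≤ j ∧ f k ≠ f (k - 1) := by
  induction j with
  | zero => exact absurd hij (Nat.not_lt_zero _)
  | succ j ih =>
    by_cases hfj : f j = f (j + 1)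
    · have hij' : i < j := by
        rcases Nat.lt_succ_iff_lt_or_eq.1 hij with h | h
        · exact h
        · exact absurd (h ▸ hfj) hne
      obtain ⟨k, hk1, hk2, hk3⟩ := ih hij' (by rw [hfj]; exact hne)
      exact ⟨k, hk1, by omega, hk3⟩
    · exact ⟨j + 1, hij, le_rfl, by rw [Nat.add_sub_cancel]; exact fun h => hfj h.symm⟩

/-! ### Genealogy of boundaries -/

include hOs hCs ho in
/-- **Genealogy of colour boundaries.**  Let `rO b ≤ n'` (all items pushed before `b` exist), and let `Tests ⊇` the push times `t ∈ [a, b)` at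
which `σ t ≠ σ (o (rC t))` (disagreement with the front).  Then the boundaries among the items `k` with `rO a < k < rO b`
(both `k − 1` and `k` pushed during `[a, b)`) number at most the boundaries among the items `k'` with `rC a < k' ≤ rC b` plus
`2 · #Tests`: a boundary between two agreeing pushes is copied from a boundary between their two fronts, and these front
intervals are disjoint for distinct pushes. [folklore] -/
theorem card_boundaries_pushed_le {a b : ℕ} (hn : rO b ≤ n') (Tests : Finset ℕ)
    (hTests : ∀ t, a ≤ t → t < b → W t = true → σ t ≠ σ (o (rC t)) → t ∈ Tests) :
    ((Ico (rO a + 1) (rO b)).filter fun k => σ (o k) ≠ σ (o (k - 1))).card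
      ≤ ((Ioc (rC a) (rC b)).filter fun k => σ (o k) ≠ σ (o (k - 1))).card + 2 * Tests.card := by
  classical
  have hmonoO : ∀ {s t : ℕ}, s ≤ t → rO s ≤ rO t := fun h => rankO_mono hOs h
  have hmonoC : ∀ {s t : ℕ}, s ≤ t → rC s ≤ rC t := fun h => rankC_mono hCs h
  set S := (Ico (rO a + 1) (rO b)).filter fun k => σ (o k) ≠ σ (o (k - 1)) with hS
  -- push times of the items of `S` and of their predecessors lie in `[a, b)`
  have hitem : ∀ k ∈ S, rO a + 1 ≤ k ∧ k < rO b := fun k hk => by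
    have := (mem_filter.1 hk).1; rw [mem_Ico] at this; exact this
  have hkn : ∀ k ∈ S, k < n' := fun k hk => lt_of_lt_of_le (hitem k hk).2 hn
  have hpush : ∀ k, rO a ≤ k → k < rO b → a ≤ o k ∧ o k < b := by
    intro k h1 h2
    have hk : k < n' := lt_of_lt_of_le h2 hn
    constructor
    · by_contra hlt
      push Not at hlt
      have := (ho k a hk).1 hlt
      omega
    · exact (ho k b hk).2 h2
  -- split off the items touched by a test
  set St := S.filter fun k => o k ∈ Tests ∨ o (k - 1) ∈ Tests with hSt
  set Sf := S.filter fun k => ¬ (o k ∈ Tests ∨ o (k - 1) ∈ Tests) with hSf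
  have hsplit : S.card = St.card + Sf.card := by
    rw [hSt, hSf, card_filter_add_card_filter_not]
  -- (1) test-touched items: at most two per test time
  have hSt_le : St.card ≤ 2 * Tests.card := by
    have hsub : St ⊆ Tests.image (fun t => rO t) ∪ Tests.image (fun t => rO t + 1) := by
      intro k hk
      rw [hSt, mem_filter] at hk
      obtain ⟨hkS, ht⟩ := hk
      have hk' := hkn k hkS
      have hk1 : k - 1 < n' := by omega
      rw [mem_union, mem_image, mem_image]
      rcases ht with ht | ht
      · exact Or.inl ⟨o k, ht, (rankO_opener hOs ho hk').1⟩
      · refine Or.inr ⟨o (k - 1), ht, ?_⟩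
        rw [(rankO_opener hOs ho hk1).1]
        have := (hitem k hkS).1
        omega
    calc St.card ≤ (Tests.image (fun t => rO t) ∪ Tests.image (fun t => rO t + 1)).card := card_le_card hsub
      _ ≤ (Tests.image (fun t => rO t)).card + (Tests.image (fun t => rO t + 1)).card := card_union_le _ _
      _ ≤ Tests.card + Tests.card := Nat.add_le_add card_image_le card_image_le
      _ = 2 * Tests.card := by ring
  -- (2) test-free items: inject into the boundaries passing the front
  have hagree : ∀ k ∈ Sf, σ (o k) = σ (o (rC (o k))) ∧ σ (o (k - 1)) = σ (o (rC (o (k - 1)))) := by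
    intro k hk
    rw [hSf, mem_filter] at hk
    obtain ⟨hkS, hnot⟩ := hk
    push Not at hnot
    obtain ⟨h1, h2⟩ := hitem k hkS
    have hk' := hkn k hkS
    have hpk := hpush k (by omega) h2
    have hpk1 := hpush (k - 1) (by omega) (by omega)
    constructor
    · by_contra hne
      exact hnot.1 (hTests (o k) hpk.1 hpk.2 (letter_opener hOs ho hk') hne)
    · by_contra hne
      exact hnot.2 (hTests (o (k - 1)) hpk1.1 hpk1.2 (letter_opener hOs ho (by omega)) hne)
  -- the copied boundary: the least boundary in `(rC (o (k-1)), rC (o k)]`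
  have hex : ∀ k ∈ Sf, ∃ k', rC (o (k - 1)) < k' ∧ k' ≤ rC (o k) ∧ σ (o k') ≠ σ (o (k' - 1)) := by
    intro k hk
    obtain ⟨hA, hB⟩ := hagree k hk
    have hkS : k ∈ S := (mem_filter.1 (by rw [hSf] at hk; exact hk)).1
    have hbd : σ (o k) ≠ σ (o (k - 1)) := (mem_filter.1 hkS).2
    have hk' := hkn k hkS
    have hlt : o (k - 1) < o k := (opener_lt_opener_iff hOs ho (by omega) hk').2 (by have := (hitem k hkS).1; omega)
    have hle : rC (o (k - 1)) ≤ rC (o k) := hmonoC hlt.le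
    have hne : σ (o (rC (o (k - 1)))) ≠ σ (o (rC (o k))) := by rw [← hA, ← hB]; exact hbd.symm
    rcases eq_or_lt_of_le hle with heq | hlt'
    · exact absurd (by rw [heq]) hne
    · exact exists_boundary_between (fun i => σ (o i)) hlt' hne
  choose! g hg using hex
  have hSf_le : Sf.card ≤ ((Ioc (rC a) (rC b)).filter fun k => σ (o k) ≠ σ (o (k - 1))).card := by
    refine Finset.card_le_card_of_injOn g ?_ ?_
    · intro k hk
      have hk' : k ∈ Sf := hk
      obtain ⟨g1, g2, g3⟩ := hg k hk'
      have hkS : k ∈ S := (mem_filter.1 (by rw [hSf] at hk'; exact hk')).1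
      obtain ⟨h1, h2⟩ := hitem k hkS
      have hpk := hpush k (by omega) h2
      have hpk1 := hpush (k - 1) (by omega) (by omega)
      rw [mem_coe, mem_filter, mem_Ioc]
      refine ⟨⟨lt_of_le_of_lt (hmonoC hpk1.1) g1, g2.trans (hmonoC hpk.2.le)⟩, g3⟩
    · intro k₁ hk₁ k₂ hk₂ hgg
      have hk₁' : k₁ ∈ Sf := hk₁
      have hk₂' : k₂ ∈ Sf := hk₂
      have hS₁ : k₁ ∈ S := (mem_filter.1 (by rw [hSf] at hk₁'; exact hk₁')).1
      have hS₂ : k₂ ∈ S := (mem_filter.1 (by rw [hSf] at hk₂'; exact hk₂')).1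
      -- the front intervals of distinct test-free items are disjoint, so equal images force equal items
      by_contra hne
      rcases lt_or_gt_of_ne hne with hlt | hlt
      · -- `g k₁ ≤ rC (o k₁) ≤ rC (o (k₂ - 1)) < g k₂`
        have h1 := (hg k₁ hk₁').2.1
        have h2 := (hg k₂ hk₂').1
        have hmono : rC (o k₁) ≤ rC (o (k₂ - 1)) := by
          rcases eq_or_lt_of_le (show k₁ ≤ k₂ - 1 by omega) with heq | hlt2
          · rw [heq]
          · exact hmonoC ((opener_lt_opener_iff hOs ho (hkn k₁ hS₁) (by have := hkn k₂ hS₂; omega)).2 hlt2).le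
        omega
      · have h1 := (hg k₂ hk₂').2.1
        have h2 := (hg k₁ hk₁').1
        have hmono : rC (o k₂) ≤ rC (o (k₁ - 1)) := by
          rcases eq_or_lt_of_le (show k₂ ≤ k₁ - 1 by omega) with heq | hlt2
          · rw [heq]
          · exact hmonoC ((opener_lt_opener_iff hOs ho (hkn k₂ hS₂) (by have := hkn k₁ hS₁; omega)).2 hlt2).le
        omega
  rw [hsplit]
  omega

end AbstractQueue

end Summit.ValiantsHypothesis.ValiantsHypothesis.Theorems.FifoMatching.NNLinearDegreeCofactorHard.QueueHistory
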